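import Literature.Topology.FourManifolds.SchoenfliesIsotopy
import Literature.Topology.FourManifolds.SchoenfliesBallForm
import Literature.Topology.FourManifolds.HCobordismIdealCircleProofs
import HarnessLib

/-!
# The Schoenflies theorem in `S³`: the last mile (all proved)

Topic `Literature/Topology/FourManifolds` (fact seat of the named fact
`Literature.Topology.FourManifolds.SphereEmbedding.schoenflies_exists_ball`,
`SchoenfliesSphereThree.lean`: Alexander's theorem, the smooth Schoenflies theorem in dimension
three, in two-sided ball form). **Everything in this file is proved; no definition and no named
fact is introduced.** The fact itself — Schultens, *Introduction to 3-Manifolds* (2014),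
Thm. 3.2.5 "any 2-sphere in `ℝ³` bounds a 3-ball" (DIFF category; proof after Casson by Morse
position, surgery along innermost level circles and induction on the number of saddles, PDF
pp. 43–45 of the held copy) — is NOT discharged here: its proof needs Morse/general position of
embedded surfaces, the smooth 2-dimensional Schoenflies theorem in level planes and on the sphere,
surgery with smoothing of corners and the ball-assembly lemmas, none of which the tree or Mathlib
has. What this file proves is that every formulation a future proof might naturally end with
already implies the vendored two-sided statement, so that the remaining content is exactly
Thm. 3.2.5 in `ℝ³` in its simplest form:

* `SphereEmbedding.schoenflies_exists_ball_of_euclidean` — **Cor. 3.2.6 and the remark after it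
  (PDF p. 45) as a theorem**: if every smoothly embedded 2-sphere `f : 𝕊 2 → ℝ³` is the image of
  the unit sphere under a smooth embedding `e : ℝ³ → ℝ³` (Thm. 3.2.5, "bounds a 3-ball" rendered
  as in the fact by an embedding of all of `ℝ³`), then `schoenflies_exists_ball` holds: for
  `S ⊆ 𝕊 3` and `p ∉ S` read `S` in the stereographic chart `σₚ : 𝕊 3 ∖ {p} ≅ ℝ³` ("`S³ = ℝ³ ∪ ∞`",
  `∞ = p`), take the Euclidean ball and carry it back by `σₚ⁻¹`; it misses `p` automatically, and
  since `p` was arbitrary both sides of `S` are balls ("another 3-ball bounded by `S''` — to the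
  other side!").
* `SphereEmbedding.schoenflies_exists_ball_iff_oneSided` — the point `p` and the two-sidedness
  carry no extra content: `schoenflies_exists_ball` is equivalent to the one-sided ball form
  `∀ S, ∃ e, e '' (unit sphere) = range S` (via Palais' disc theorem in the sphere, i.e. the proved
  `exists_diffeomorph_image_eq_iff_exists_ball` / `exists_ball_not_mem_of_diffeomorph_image_eq` of
  `SchoenfliesBallForm.lean`).
* `SphereEmbedding.schoenflies_exists_ball_iff_exists_diffeomorph`,
  `SphereEmbedding.schoenflies_exists_ball_iff_isotopy` — equivalence with the equator form (some
  diffeomorphism of `𝕊 3` carries `range S` onto `sphereEquator 2 = {x₃ = 0}`) and with the second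
  named fact of `SchoenfliesSphereThree.lean`, the isotopy form
  `schoenflies_exists_ambientIsotopy_image_eq_sphereEquator` (ball ⇒ isotopy is the tree's
  `schoenflies_exists_ambientIsotopy_image_eq_sphereEquator_of_ball`, `SchoenfliesIsotopy.lean`;
  isotopy ⇒ diffeomorphism ⇒ ball is immediate from `SchoenfliesBallForm.lean`). Hence the two
  named facts of `SchoenfliesSphereThree.lean` are ONE piece of trust, not two.

## References

* J. Schultens, *Introduction to 3-Manifolds*, GSM 151, AMS (2014), Thm. 3.2.5 (PDF p. 43 of the
  held copy `book:schultens2014-introduction-3-manifolds`), Cor. 3.2.6 and the remark following its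
  proof (PDF p. 45). [Schultens2014]
* M. W. Hirsch, *Differential Topology*, GTM 33 (1976), Ch. 8 §3, Thm. 3.1 (disc theorem).
  [HirschDT1976]
* R. Palais, *Extending diffeomorphisms*, Proc. AMS 11 (1960) 274–277. [Palais1960]

## Design notes

* Sibling `…Proofs.lean` file rather than an edit of `SchoenfliesSphereThree.lean`: the proofs
  need `SchoenfliesBallForm.lean`, `SchoenfliesIsotopy.lean` (which imports
  `SchoenfliesSphereThree.lean`) and the post-composition lemma
  `Manifold.IsImmersion.openPartialHomeomorph_comp` (`HCobordismIdealCircleProofs.lean`).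
* The Euclidean hypothesis of `schoenflies_exists_ball_of_euclidean` is written out as a `Prop`
  binder, not vendored as a new `def` (D-0026: no new named fact in a fact seat; it would be
  Thm. 3.2.5 itself).
* No local notation and no local instances (so that the file is pure theorems): the spheres are
  spelled out as `sphere (0 : EuclideanSpace ℝ (Fin (k + 1))) 1`, the expansion of the local
  notation `𝕊 k` of `SchoenfliesSphereThree.lean`, and `Fact (finrank ℝ ℝ⁴ = 3 + 1)` (needed for
  `stereographic' 3 p` and the `V`-generic lemmas of `SchoenfliesBallForm.lean`) is supplied
  inside the proofs, as in `SchoenfliesBallForm.lean`.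
-/

open scoped Manifold ContDiff Topology RealInnerProductSpace
open Function Set Metric Module

noncomputable section

namespace Literature.Topology.FourManifolds

namespace SphereEmbedding

/-! ### The equator as a great sphere -/

/-- The great sphere of `𝕊 3` orthogonal to `e₃ = (0, 0, 0, 1)` is the standard equator
`sphereEquator 2 = {x | x₃ = 0}` of `Knots.lean`. [folklore] -/
theorem setOf_inner_single_eq_zero_eq_sphereEquator :
    {q : sphere (0 : EuclideanSpace ℝ (Fin (3 + 1))) 1 |
        ⟪(q : EuclideanSpace ℝ (Fin (3 + 1))), EuclideanSpace.single (Fin.last 3) (1 : ℝ)⟫ = 0} =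
      sphereEquator 2 := by
  ext q
  rw [mem_sphereEquator_iff]
  simp [EuclideanSpace.inner_single_right]

/-! ### One-sided and two-sided ball forms agree -/

/-- **The point `p` carries no extra content.** The two-sided ball form
`schoenflies_exists_ball` (for every `p ∉ S` a smoothly embedded closed ball bounded by `S` and
missing `p`) is equivalent to the one-sided form: every smoothly embedded 2-sphere `S ⊆ 𝕊 3` is
`e(∂𝔻³)` for some smooth embedding `e : ℝ³ → 𝕊 3`. (`⇒`: a 2-sphere in `𝕊 3` misses a point,
`SphereEmbedding.exists_notMem_range`; `⇐`: by Palais' disc theorem the bounding ball is standard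
up to a diffeomorphism of `𝕊 3`, `exists_diffeomorph_image_eq_iff_exists_ball`, and then both
closed hemispheres pull back to balls, `exists_ball_not_mem_of_diffeomorph_image_eq` — Schultens'
remark after Cor. 3.2.6: "another 3-ball bounded by `S''` — to the other side!".)
[cite: Schultens2014, Cor. 3.2.6 and remark (PDF p. 45)] -/
theorem schoenflies_exists_ball_iff_oneSided :
    schoenflies_exists_ball ↔
      ∀ S : SphereEmbedding 2 3,
        ∃ e : EuclideanSpace ℝ (Fin 3) → sphere (0 : EuclideanSpace ℝ (Fin (3 + 1))) 1,
          Manifold.IsSmoothEmbedding 𝓘(ℝ, EuclideanSpace ℝ (Fin 3)) (𝓡 3) ∞ e ∧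
            e '' sphere (0 : EuclideanSpace ℝ (Fin 3)) 1 = range S := by
  constructor
  · intro h S
    obtain ⟨p, hp⟩ := S.exists_notMem_range (by norm_num)
    obtain ⟨e, he, heS, -⟩ := h S p hp
    exact ⟨e, he, heS⟩
  · intro h S p hp
    haveI : Fact (finrank ℝ (EuclideanSpace ℝ (Fin (3 + 1))) = 3 + 1) :=
      ⟨finrank_euclideanSpace_fin⟩
    obtain ⟨e, he, heS⟩ := h S
    obtain ⟨u, -⟩ : ∃ u : sphere (0 : EuclideanSpace ℝ (Fin (3 + 1))) 1,
        (u : EuclideanSpace ℝ (Fin (3 + 1))) = EuclideanSpace.single (Fin.last 3) (1 : ℝ) :=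
      ⟨⟨_, by simp⟩, rfl⟩
    obtain ⟨φ, hφ⟩ :=
      (exists_diffeomorph_image_eq_iff_exists_ball (n := 3) u (range S)).mpr ⟨e, he, heS⟩
    exact exists_ball_not_mem_of_diffeomorph_image_eq u φ hφ hp

/-! ### Equator form and isotopy form -/

/-- **Equator form ⇒ ball form.** If some diffeomorphism of `𝕊 3` carries `range S` onto the
equator `{x₃ = 0}` for every smoothly embedded 2-sphere `S`, then `schoenflies_exists_ball`
holds (the equator is the great sphere `e₃ᗮ ∩ 𝕊 3`; pull the closed hemispheres back,
`exists_ball_not_mem_of_diffeomorph_image_eq`). [folklore] -/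
theorem schoenflies_exists_ball_of_exists_diffeomorph
    (h : ∀ S : SphereEmbedding 2 3,
      ∃ φ : sphere (0 : EuclideanSpace ℝ (Fin (3 + 1))) 1 ≃ₘ⟮𝓡 3, 𝓡 3⟯
          sphere (0 : EuclideanSpace ℝ (Fin (3 + 1))) 1,
        φ '' range S = sphereEquator 2) :
    schoenflies_exists_ball := by
  intro S p hp
  haveI : Fact (finrank ℝ (EuclideanSpace ℝ (Fin (3 + 1))) = 3 + 1) :=
    ⟨finrank_euclideanSpace_fin⟩
  obtain ⟨φ, hφ⟩ := h S
  obtain ⟨u, hu⟩ : ∃ u : sphere (0 : EuclideanSpace ℝ (Fin (3 + 1))) 1,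
      (u : EuclideanSpace ℝ (Fin (3 + 1))) = EuclideanSpace.single (Fin.last 3) (1 : ℝ) :=
    ⟨⟨_, by simp⟩, rfl⟩
  have hφ' : φ '' range S = {q : sphere (0 : EuclideanSpace ℝ (Fin (3 + 1))) 1 |
      ⟪(q : EuclideanSpace ℝ (Fin (3 + 1))), (u : EuclideanSpace ℝ (Fin (3 + 1)))⟫ = 0} := by
    rw [hφ, hu, setOf_inner_single_eq_zero_eq_sphereEquator]
  exact exists_ball_not_mem_of_diffeomorph_image_eq u φ hφ' hp

/-- **Ball form ⇔ equator form** for smoothly embedded 2-spheres in `𝕊 3`: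
`schoenflies_exists_ball` holds iff every `range S` is carried onto the equator
`sphereEquator 2` by a diffeomorphism of `𝕊 3` (`⇒` through the isotopy form,
`schoenflies_exists_ambientIsotopy_image_eq_sphereEquator_of_ball`, taking the end stage of the
ambient isotopy; `⇐` is `schoenflies_exists_ball_of_exists_diffeomorph`). This is the dimension-3
case of `exists_diffeomorph_image_eq_iff_exists_ball` in the tree's coordinates.
[cite: Schultens2014, Thm. 3.2.5 (PDF p. 43) with §4.1 (PDF p. 71)] -/
theorem schoenflies_exists_ball_iff_exists_diffeomorph :
    schoenflies_exists_ball ↔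
      ∀ S : SphereEmbedding 2 3,
        ∃ φ : sphere (0 : EuclideanSpace ℝ (Fin (3 + 1))) 1 ≃ₘ⟮𝓡 3, 𝓡 3⟯
            sphere (0 : EuclideanSpace ℝ (Fin (3 + 1))) 1,
          φ '' range S = sphereEquator 2 := by
  refine ⟨fun h S ↦ ?_, schoenflies_exists_ball_of_exists_diffeomorph⟩
  obtain ⟨F, hF⟩ := schoenflies_exists_ambientIsotopy_image_eq_sphereEquator_of_ball h S
  exact ⟨F.toDiffeomorph 1, hF⟩

/-- **The two named facts of `SchoenfliesSphereThree.lean` are equivalent**: the ball form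
`schoenflies_exists_ball` (Schultens (2014), Thm. 3.2.5 with Cor. 3.2.6) and the isotopy form
`schoenflies_exists_ambientIsotopy_image_eq_sphereEquator` (ibid. §4.1: up to isotopy the
standard 2-sphere is the only 2-knot in `S³`). Ball ⇒ isotopy is the disc theorem
(`SchoenfliesIsotopy.lean`); isotopy ⇒ ball takes the end-stage diffeomorphism and pulls the
closed hemispheres back. [cite: Schultens2014, Thm. 3.2.5 (PDF p. 43) with §4.1 (PDF p. 71)] -/
theorem schoenflies_exists_ball_iff_isotopy :
    schoenflies_exists_ball ↔ schoenflies_exists_ambientIsotopy_image_eq_sphereEquator := by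
  refine ⟨schoenflies_exists_ambientIsotopy_image_eq_sphereEquator_of_ball, fun h ↦
    schoenflies_exists_ball_of_exists_diffeomorph fun S ↦ ?_⟩
  obtain ⟨F, hF⟩ := h S
  exact ⟨F.toDiffeomorph 1, hF⟩

/-! ### From `ℝ³` to `S³ = ℝ³ ∪ {∞}` -/

/-- **Schoenflies in `ℝ³` implies Schoenflies in `S³`, both sides** (Schultens (2014), proof of
Cor. 3.2.6 and the remark after it, PDF p. 45: "`S³ = ℝ³ ∪ ∞` … the Schönflies Theorem furnishes
a 3-ball bounded by `S''` (in `ℝ³ ⊂ S³`)" and "another 3-ball bounded by `S''` — to the other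
side!"). Hypothesis: Thm. 3.2.5 in `ℝ³` in the rendering of the fact — every smooth embedding
`f : 𝕊 2 → ℝ³` has `range f = e(∂𝔻³)` for a smooth embedding `e : ℝ³ → ℝ³`. Conclusion: the named
fact `schoenflies_exists_ball`. Proof: for `S ⊆ 𝕊 3` and `p ∉ S` let `σ = σₚ` be the stereographic
chart from `p` (source `{p}ᶜ ⊇ range S`, target `ℝ³`); `σ ∘ S` is a smooth embedding
(post-composition of an immersion with a partial diffeomorphism defined on its image,
`Manifold.IsImmersion.openPartialHomeomorph_comp`; a continuous injection of a compact space is an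
embedding); if `e₀` is the Euclidean ball for `σ ∘ S` then `e = σ⁻¹ ∘ e₀` is a smooth embedding
`ℝ³ → 𝕊 3` with `e(∂𝔻³) = σ⁻¹(σ(range S)) = range S`, and `range e ⊆ σ.source = {p}ᶜ`.
[cite: Schultens2014, Cor. 3.2.6 and remark (PDF p. 45)] -/
theorem schoenflies_exists_ball_of_euclidean
    (h : ∀ f : sphere (0 : EuclideanSpace ℝ (Fin (2 + 1))) 1 → EuclideanSpace ℝ (Fin 3),
      Manifold.IsSmoothEmbedding (𝓡 2) 𝓘(ℝ, EuclideanSpace ℝ (Fin 3)) ∞ f →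
        ∃ e : EuclideanSpace ℝ (Fin 3) → EuclideanSpace ℝ (Fin 3),
          Manifold.IsSmoothEmbedding 𝓘(ℝ, EuclideanSpace ℝ (Fin 3))
              𝓘(ℝ, EuclideanSpace ℝ (Fin 3)) ∞ e ∧
            e '' sphere (0 : EuclideanSpace ℝ (Fin 3)) 1 = range f) :
    schoenflies_exists_ball := by
  intro S p hp
  haveI : Fact (finrank ℝ (EuclideanSpace ℝ (Fin (3 + 1))) = 3 + 1) :=
    ⟨finrank_euclideanSpace_fin⟩
  -- the stereographic chart from `p`
  set σ : OpenPartialHomeomorph (sphere (0 : EuclideanSpace ℝ (Fin (3 + 1))) 1)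
      (EuclideanSpace ℝ (Fin 3)) := stereographic' 3 p with hσ
  have hsrc : σ.source = {p}ᶜ := stereographic'_source p
  have htgt : σ.target = univ := stereographic'_target p
  have hatlas : σ ∈ IsManifold.maximalAtlas (𝓡 3) ∞
      (sphere (0 : EuclideanSpace ℝ (Fin (3 + 1))) 1) :=
    IsManifold.subset_maximalAtlas (stereographic'_mem_atlas p)
  have hσs : ContMDiffOn (𝓡 3) (𝓡 3) ∞ σ σ.source := contMDiffOn_of_mem_maximalAtlas hatlas
  have hσs' : ContMDiffOn (𝓡 3) (𝓡 3) ∞ σ.symm σ.target :=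
    contMDiffOn_symm_of_mem_maximalAtlas hatlas
  have hSsrc : ∀ x, S x ∈ σ.source := fun x ↦ by
    rw [hsrc, mem_compl_singleton_iff]
    rintro hx
    exact hp ⟨x, hx⟩
  -- `σ ∘ S : 𝕊 2 → ℝ³` is a smooth embedding
  have hf : Manifold.IsSmoothEmbedding (𝓡 2) 𝓘(ℝ, EuclideanSpace ℝ (Fin 3)) ∞ (σ ∘ S) := by
    refine ⟨S.isSmoothEmbedding.isImmersion.openPartialHomeomorph_comp σ hσs hσs' hSsrc, ?_⟩
    have hc : Continuous (σ ∘ S) := σ.continuousOn.comp_continuous S.continuous hSsrc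
    have hi : Injective (σ ∘ S) := fun x y hxy ↦
      S.injective (σ.injOn (hSsrc x) (hSsrc y) hxy)
    exact (hc.isClosedEmbedding hi).isEmbedding
  obtain ⟨e₀, he₀, he₀S⟩ := h (σ ∘ S) hf
  have hsymm_src : ∀ y, e₀ y ∈ σ.symm.source := fun y ↦ by
    rw [σ.symm_source, htgt]
    exact mem_univ _
  refine ⟨σ.symm ∘ e₀, ⟨?_, ?_⟩, ?_, ?_⟩
  · -- immersion: post-compose with the partial diffeomorphism `σ⁻¹`
    refine he₀.isImmersion.openPartialHomeomorph_comp σ.symm ?_ ?_ hsymm_src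
    · rw [σ.symm_source]
      exact hσs'
    · rw [σ.symm_symm, σ.symm_target]
      exact hσs
  · -- topological embedding
    exact (isSmoothEmbedding_stereographic'_symm p).isEmbedding.comp he₀.isEmbedding
  · -- `e(∂𝔻³) = σ⁻¹(σ(range S)) = range S`
    rw [image_comp, he₀S, range_comp]
    exact σ.symm_image_image_of_subset_source fun y hy ↦ by
      obtain ⟨x, rfl⟩ := hy
      exact hSsrc x
  · -- the ball misses `p`: `range (σ⁻¹ ∘ e₀) ⊆ σ.source = {p}ᶜ`
    rintro ⟨y, -, hy⟩
    have hmem : σ.symm (e₀ y) ∈ σ.source := σ.map_target (by rw [htgt]; exact mem_univ _)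
    rw [hsrc, mem_compl_singleton_iff] at hmem
    exact hmem hy

end SphereEmbedding

end Literature.Topology.FourManifolds

end
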